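import Literature.NumberTheory.GaloisCohomology.PoitouTateRestrictedShaReadoutRoad
import HarnessLib

/-!
# Naturality of the `S`-restricted `Ш`-pairing of the readout road in the module
# (Milne I Thm. 4.10 (a): the pairing is canonical), ABSTRACT form

Theorems only (no definition, no named fact, no `sorry`, no instance, no notation).  Topic
`NumberTheory/GaloisCohomology`; namespace `Literature.NumberTheory.GaloisCohomology.ShaReadoutRoad`.
Lane «PT-Ш-S-TC» of cell `bsd-eis` (crux `GoodLatticeBDPValue`), brick D5b: clause (N) of the named
fact `poitouTate_shaRestricted_tateDual_natural(_at)` for the DEFINED pairing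
`ShaReadoutRoad.levelPairing` of `PoitouTateRestrictedShaReadoutRoad.lean`, reduced to three displayed
compatibilities of the road's data with a MORPHISM OF PRESENTATIONS.

THE MATHEMATICS.  Two modules `M` (level `n`) and `M'` (level `n'`) are run on the SAME class-formation
side (`𝒞`, `P`, `CS`, `JS`, `gJ`, `inv`) with presentations `SC`, `SC'` and bridges `(nat, Ψ)`,
`(nat', Ψ')`.  A morphism of presentations `φ : SC' ⟶ SC` (the direction of the adjoint map
`G : M'^D → M^D` of the presented objects; for the kernel-monotone `G` of the lane it is the canonical
one, memo `D5-NATURALITY-SCOPING-w2g11.md` §5) acts on the three ingredients of the value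
`B(c, z) = inv (nat z ∘ ∂h_c)` (`levelPairing_apply_of_eq`, ANY lift `h_c`):
* the boundary: `∂'(φ₁ ≫ h) = φ₃^* ∂h` — PROVED here for any abelian category
  (`boundary_comp_hom`, from Mathlib's `ShortComplex.ShortExact.extClass_naturality`);
* the obstruction map: `Ψ'(φ₁ ≫ h_c)` is the image `x'` of `c` (hypothesis `hΨφ`, pointwise);
* the bridge: `nat z = nat' z' ≫ φ₃` when `z` is the image of `z'` (hypothesis `hnatφ`, pointwise).
Then **`levelPairing_natural`**: `B'(x', z') = B(c, z)` — the displayed shape of (N) with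
`x' = F_* c`, `z = G_* z'`.  The two pointwise hypotheses are what the module-morphism companion lemmas
of the lane's `Ψ_S` (D4a) and `nat_S` (F1, `ExtOneDescent.extOneToH1_map`, p707900) deliver at the
instantiation (D5c).  No arithmetic is proved here; nothing about Poitou–Tate duality itself or BSD.
AI formalisation, weaker than expert review; established only by the kernel check.

## References
* J. S. Milne, *Arithmetic Duality Theorems*, 2nd ed. (2006), I Thm. 4.10 (a) ("canonical"), §4 p. 65.
  [MilneADT2006]
* D. Harari, *Galois Cohomology and Class Field Theory* (2020), §16.2 (16.4) (naturality of the Yoneda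
  pairing), Thm. 17.13 (b). [Harari2020]
-/

noncomputable section

open Function NumberField IsDedekindDomain CategoryTheory CategoryTheory.Abelian
open scoped NumberField

universe w v u

namespace Literature.NumberTheory.GaloisCohomology

open Literature.NumberTheory.GaloisRepresentations
open Literature.NumberTheory.GaloisRepresentations.DiscreteGaloisModule (TateDual tateDual
  restrictedCohomology restrictedLocalization shaRestricted localTatePairingZMod)
open Literature.Algebra.Homology Literature.Algebra.Homology.ExtPresentation Literature.Algebra.Homology.ExtDuality
open Literature.AnabelianGeometry.AbsoluteAnabelian.Prop121vii (zmodToQmodZ)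

namespace ShaReadoutRoad

/-! ## §1 The boundary of a presentation is natural in the presentation -/

section Boundary

variable {𝒞 : Type u} [Category.{v} 𝒞] [Abelian 𝒞] [HasExt.{w} 𝒞]

/-- **`∂_{S'}(φ₁ ≫ g) = φ₃^* ∂_S(g)`** for a morphism `φ : S' ⟶ S` of short exact sequences and
`g : S.X₁ ⟶ X`: the boundary `Hom(X₁, X) → Ext¹(X₃, X)` is natural in the presentation (Mathlib's
`ShortComplex.ShortExact.extClass_naturality`). [cite: Harari2020, §16.2 (16.4)] -/
theorem boundary_comp_hom {S S' : ShortComplex 𝒞} (hS : S.ShortExact) (hS' : S'.ShortExact)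
    (φ : S' ⟶ S) {X : 𝒞} (g : S.X₁ ⟶ X) :
    boundary hS' X (φ.τ₁ ≫ g) = (Ext.mk₀ φ.τ₃).comp (boundary hS X g) (zero_add 1) := by
  rw [boundary_apply, boundary_apply, ← Ext.mk₀_comp_mk₀,
    ← Ext.comp_assoc_of_third_deg_zero hS'.extClass (Ext.mk₀ φ.τ₁) (Ext.mk₀ g) (add_zero 1),
    hS'.extClass_naturality hS φ]
  exact Ext.comp_assoc _ _ _ (zero_add 1) (add_zero 1) (by omega)

end Boundary

/-! ## §2 Naturality of `levelPairing` -/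

section Natural

variable {K : Type} [Field K] [NumberField K]
  {M : Type} [AddCommGroup M] [TopologicalSpace M] [DiscreteTopology M] [Finite M]
  {M' : Type} [AddCommGroup M'] [TopologicalSpace M'] [DiscreteTopology M'] [Finite M']
  {n n' : ℕ} [NeZero n] [NeZero n']
  (ρ : DiscreteGaloisModule K M) (ρ' : DiscreteGaloisModule K M') (S : Set (HeightOneSpectrum (𝓞 K)))
  {𝒞 : Type u} [Category.{v} 𝒞] [Abelian 𝒞] [HasExt.{w} 𝒞]
  {P CS : 𝒞} (inv : Ext P CS 2 →+ AddCircle (1 : ℚ))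
  {SC SC' : ShortComplex 𝒞} (hSC : SC.ShortExact) (hSC' : SC'.ShortExact)
  (nat : restrictedCohomology (ρ.tateDual n) S 1 →+ Ext P SC.X₃ 1)
  (nat' : restrictedCohomology (ρ'.tateDual n') S 1 →+ Ext P SC'.X₃ 1)
  (Sig : Finset (Place K)) (linv : LocalInvariants K n) (linv' : LocalInvariants K n')
  {JS : 𝒞} (gJ : JS ⟶ CS)
  (R : ∀ v : Place K, (SC.X₁ ⟶ JS) →+ galoisCohomology (ρ.toLocal v) 1)
  (R' : ∀ v : Place K, (SC'.X₁ ⟶ JS) →+ galoisCohomology (ρ'.toLocal v) 1)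
  (Ψ : (SC.X₁ ⟶ CS) →+ restrictedCohomology ρ S 2)
  (Ψ' : (SC'.X₁ ⟶ CS) →+ restrictedCohomology ρ' S 2)

/-- **Naturality of the readout-road pairing in the module** (clause (N) of Milne I Thm. 4.10 (a) /
`poitouTate_shaRestricted_tateDual_natural`, ABSTRACT form).  Run the road for `M` (level `n`) and `M'`
(level `n'`) on the same class-formation side; let `φ : SC' ⟶ SC` be a morphism of the presentations such
that (i) `Ψ'` of the transported lift `φ₁ ≫ h` of `c ∈ Ш²_S(K, M)` is the class `x' ∈ Ш²_S(K, M')`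
(`hΨφ`: "`x' = F_* c`" read through the obstruction maps) and (ii) `nat z = nat' z' ≫ φ₃`
(`hnatφ`: "`z = G_* z'`" read through the bridges).  Then `B'(x', z') = B(c, z)`.  Proof:
`B'(x', z') = inv (nat' z' ∘ ∂'(φ₁ ≫ h_c)) = inv (nat' z' ∘ φ₃^* ∂h_c) = inv ((nat' z' ≫ φ₃) ∘ ∂h_c)
= inv (nat z ∘ ∂h_c) = B(c, z)` (`boundary_comp_hom`, associativity of the Yoneda composition, and the
lift-independence `levelPairing_apply_of_eq` on both sides). [cite: MilneADT2006, I Thm. 4.10 (a) and §4 p. 65]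
[cite: Harari2020, §16.2 (16.4)] -/
theorem levelPairing_natural
    (hSig₂ : ∀ v : HeightOneSpectrum (𝓞 K), (Sum.inr v : Place K) ∈ Sig ↔ v ∈ S)
    (hR4 : ∀ (f : SC.X₁ ⟶ JS) (y : restrictedCohomology (ρ.tateDual n) S 1),
      zmodToQmodZ n (∑ v ∈ Sig, localTatePairingZMod ρ n v (linv v) (R v f)
        (restrictedLocalization (ρ.tateDual n) S v 1 y)) =
        inv ((nat y).comp (boundary hSC CS (f ≫ gJ)) (rfl : 1 + 1 = 2)))
    (hΨker : ∀ h : SC.X₁ ⟶ CS, Ψ h = 0 → ∃ f : SC.X₁ ⟶ JS, h = f ≫ gJ)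
    (hΨsurj : ∀ c ∈ shaRestricted ρ S 2, ∃ h : SC.X₁ ⟶ CS, Ψ h = c)
    (hR4' : ∀ (f : SC'.X₁ ⟶ JS) (y : restrictedCohomology (ρ'.tateDual n') S 1),
      zmodToQmodZ n' (∑ v ∈ Sig, localTatePairingZMod ρ' n' v (linv' v) (R' v f)
        (restrictedLocalization (ρ'.tateDual n') S v 1 y)) =
        inv ((nat' y).comp (boundary hSC' CS (f ≫ gJ)) (rfl : 1 + 1 = 2)))
    (hΨker' : ∀ h : SC'.X₁ ⟶ CS, Ψ' h = 0 → ∃ f : SC'.X₁ ⟶ JS, h = f ≫ gJ)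
    (hΨsurj' : ∀ c ∈ shaRestricted ρ' S 2, ∃ h : SC'.X₁ ⟶ CS, Ψ' h = c)
    (φ : SC' ⟶ SC)
    (c : ↥(shaRestricted ρ S 2)) (x' : ↥(shaRestricted ρ' S 2))
    (hΨφ : ∀ h : SC.X₁ ⟶ CS, Ψ h = c → Ψ' (φ.τ₁ ≫ h) = x')
    (z' : ↥(shaRestricted (ρ'.tateDual n') S 1)) (z : ↥(shaRestricted (ρ.tateDual n) S 1))
    (hnatφ : nat (z : restrictedCohomology (ρ.tateDual n) S 1) =
      (nat' (z' : restrictedCohomology (ρ'.tateDual n') S 1)).comp (Ext.mk₀ φ.τ₃) (add_zero 1)) :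
    levelPairing ρ' S inv hSC' nat' Sig linv' gJ R' Ψ' hSig₂ hR4' hΨker' hΨsurj' x' z' =
      levelPairing ρ S inv hSC nat Sig linv gJ R Ψ hSig₂ hR4 hΨker hΨsurj c z := by
  -- a lift of `c` and its transport, a lift of `x'`
  obtain ⟨h, hh⟩ := hΨsurj c.1 c.2
  rw [levelPairing_apply_of_eq ρ' S inv hSC' nat' Sig linv' gJ R' Ψ' hSig₂ hR4' hΨker' hΨsurj' x'
      (hΨφ h hh) z',
    levelPairing_apply_of_eq ρ S inv hSC nat Sig linv gJ R Ψ hSig₂ hR4 hΨker hΨsurj c hh z,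
    boundary_comp_hom hSC hSC' φ h, hnatφ,
    Ext.comp_assoc_of_second_deg_zero _ (Ext.mk₀ φ.τ₃) (boundary hSC CS h) (rfl : 1 + 1 = 2)]

end Natural

end ShaReadoutRoad

end Literature.NumberTheory.GaloisCohomology

end
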